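import Literature.NumberTheory.EllipticCurves.GreenbergSelmerNewformDatum
import Literature.NumberTheory.EllipticCurves.TateModule
import Literature.NumberTheory.EllipticCurves.IwasawaAlgebra
import Literature.NumberTheory.EllipticCurves.Isogeny
import Literature.NumberTheory.EllipticCurves.Tamagawa
import Literature.NumberTheory.EllipticCurves.GlobalMinimalModel
import Literature.NumberTheory.DiophantineGeometry.Conductor
import Mathlib.RingTheory.Ideal.Height
import Mathlib.Topology.Algebra.Nonarchimedean.AdicTopology
import Mathlib.LinearAlgebra.Matrix.Transvection
import HarnessLib

/-!
# The big ordinary Galois representation of a Hida family through an elliptic curve: an interface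

Topic `Literature/NumberTheory/EllipticCurves` (definition request `defn-HidaFamilyGaloisRepDatum`
= D-Λ1 of the BSD cell bsd-f3-mu, CANDIDATES §4; wanted by `stmt-BirchSwinnertonDyer-20547`, route
`OneSidedTwistSqueezeX9`, ROW 45 «prime-adapted Kolyvagin element / unipotent level supply»).

For an elliptic curve `E/ℚ` (a Weierstrass cubic `W`), non-CM, with good ORDINARY reduction at a
prime `p ≥ 5` and `E[p]` irreducible, Hida theory attaches to the `p`-stabilisation of the newform
`f_E` a primitive irreducible component of the ordinary `Λ`-adic Hecke algebra of tame level `N_E`,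
with normalisation a local domain `𝕀` finite over `Λ = ℤ_p⟦X⟧`, and a "big" Galois representation

  `ρ_𝓕 : Gal(ℚ̄/ℚ) → GL₂(𝕀)`,

continuous for the `𝔪_𝕀`-adic topology, unramified outside `N_E p`, whose reductions modulo the
arithmetic (classical) height-one primes are Deligne's representations of the classical `p`-ordinary
members of the family, whose reduction modulo the point of `f_E` is `T_p E`, and which is ORDINARY at
`p`: `ρ_𝓕|_{G_{ℚ_p}} = (ε ∗; 0 δ)` with `δ` unramified and `ε|_{I_p}` of infinite order.

This file is an INTERFACE: the structure `HidaFamilyGaloisRepDatum W p I` records such a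
representation over a GIVEN coefficient ring `I` (an unbundled carrier with type-class binders — no
instance is declared in this file) by hypothesis fields (i)–(vi) below, exactly as the tree records
Emerton–Pollack–Weston's integral ordinary datum of ONE newform in
`Literature.NumberTheory.EllipticCurves.GreenbergSelmer.OrdinaryNewformDatum`. NOTHING is asserted:
the EXISTENCE of a datum in the regime `HidaFamilyGaloisRepDatum.Regime W p` (Hida 1986, Thm. 2.1 =
Thm. II of the introduction; freeness of the lattice and the integral ordinary filtration from the
`p`-distinguishedness of `ρ̄_{E,p}|_{G_{ℚ_p}}`, Mazur–Wiles 1986, Wiles 1988 Thm. 2.2) is a separate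
cite fact, not vendored here; statements consume `D : HidaFamilyGaloisRepDatum W p I` as a binder.

On top of the datum the file defines the group-theoretic objects of the «level supply» criterion of
ROW 45 (Conti–Lang–Medvedovsky §2.3–2.4, Ochiai 2005 Def. 2.3 (Im)): the congruence kernel
`Γ_𝕀(𝔪)`, Pink's group `Γ = ρ(G_{ℚ(μ_{p^∞})}) ∩ Γ_𝕀(𝔪) ∩ SL₂(𝕀)`, the unipotent LEVEL groups
`𝔲⁺ = {u : (1 u; 0 1) ∈ Γ}`, `𝔲⁻`, the predicate `LevelSupplyAt P := ¬ (𝔲⁺ ⊆ P ∧ 𝔲⁻ ⊆ P)` at an ideal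
`P ⊆ 𝕀` (and its two-sided variant), the reduction `ρ mod P` and «finite projective image mod `P`»
— first for an arbitrary subgroup of `GL₂` of a local ring (namespace `HidaFamily`, §1), then
specialised to the datum (§3) — and PROVES the elementary API: `𝔲^±` are additive subgroups,
`det ρ(σ) = 1 ↔ σ ∈ G_{ℚ(μ_{p^∞})}` (so `Γ = im ρ ∩ Γ_𝕀(𝔪) ∩ SL₂`, CLM's `Γ_ρ`), the unfolding
lemmas, the implication two-sided ⇒ one-sided supply, and the Greenberg–Selmer glue: the line
`𝕀·e₁` is an `OrdinaryFiltration` of `ρ_𝓕` at every place above `p` (§3, `ordinaryFiltration`).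

## The fields (i)–(vi) and their sources (as printed)

* (i) `𝕀`: "Let `𝒦` be a primitive local ring of `φ(N; K)` and let `𝓘(𝒦)` be the integral closure
  of `Λ_K` in `𝒦`" — an integral domain finite over `Λ` (Hida 1986, §1–§2, p. 558); CLM §1:
  "`A` is a domain that is finite over `Λ := ℤ_p⟦X⟧`" and "local pro-`p` ring" (complete local,
  finite residue field). Here: `[CommRing I] [IsDomain I] [IsLocalRing I]`, `Module.Finite Λ I`, the
  residue field finite of characteristic `p`, the topology the `𝔪_I`-adic one (`IsAdic`).
* (ii) `ρ`: Hida 1986, Thm. 2.1 (p. 559): "there exists a continuous representation of `𝔊` into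
  `GL₂(𝒦)` characterized by (2.2a) `π` is simple; (2.2b) `π` is unramified outside `Np`; (2.2c) for
  each ordinary form `f` of weight `k ≥ 2` belonging to `𝒦`, the reduction `π mod P_f` is equivalent
  to `π(f)`", continuity meaning (p. 558–559) "realized on … an `𝓘(𝒦)`-lattice `L` stable under `𝔊`,
  `π : 𝔊 → Aut(L)` continuous for the projective limit topology `Aut(L) = lim Aut(L/𝔪ʲL)`". Here the
  lattice is FREE (the frame `Fin 2 → I`; automatic when `ρ̄` is absolutely irreducible) and `ρ` is a
  `FramedGaloisRep ℚ I 2 = (Γ_ℚ →ₜ* GL (Fin 2) I)`, unramified at every finite place of residue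
  characteristic `ℓ ∤ N_W p` (`FramedGaloisRep.IsUnramifiedAt`).
* (iii) determinant: Hida 1986, p. 560: "`det(π)` coincides with the character `ψχ⁻¹·ι`", `χ` the
  `p`-adic cyclotomic character, `ι : Γ = 1 + pℤ_p → Λ^×` the tautological character regarded as a
  character of `𝔊` "via the cyclotomic character", `ψ` the (finite order) character of `𝒦` — for the
  family through `f_E` (trivial Nebentypus, `p ∤ N`) a power of the Teichmüller character, so that
  `det ρ_𝓕 = ψ ∘ χ_p` for an INJECTIVE continuous `ψ : ℤ_p^× → 𝕀^×` (US-S4 (o4):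
  "`det ρ_𝓕(σ) = 1 ⟺ σ ∈ G^cyc` (injectivity of `u ↦ ω(u)[⟨u⟩]`)"). Here: `detChar`, `det_eq`.
* (iv) ordinarity, in the frame: CLM Prop. 6.6 (proof): "there is a `(t,d)`-representation `ρ` such
  that `ρ|_{G_{ℚ_p}} = (ε ∗; 0 δ)` with `δ` unramified and `ε(g₀) = (1+X ∗; 0 1)` for some `g₀` in the
  inertia subgroup at `p`" (Wiles 1988 Thm. 2.2; EPW (eq:ordes)). Here, at every place `v ∋ p` and
  in the given frame: the lower-left entry of `ρ(σ)` vanishes for `σ ∈ D_v`, the lower-right entry is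
  `1` for `σ ∈ I_v` (unramified rank-one quotient), and the upper-left entry `θ(σ)` is of infinite
  order for some `σ ∈ I_v`.
* (v) specialisations: Hida 1986, Thm. 2.1 (2.2c) and p. 559: "The subset of `𝒳(𝒦)(Ω)` of the
  points obtained from ordinary forms is dense under the Zariski topology"; (2.1b):
  "`det(1 − π(σ_l)X) = 1 − a(l, f)X + ψ(l)l^{k−1}X²`" for `l ∤ Np`. Here: a Zariski-dense set
  `arithPoints` of ring homomorphisms `φ : I →+* ℚ̄_p` with `|φ| ≤ 1`, each lying over an arithmetic
  point `X ↦ (1+p)^{k−2} − 1` of `Λ` and carrying a `p`-ordinary newform `g ∈ S_k(Γ₀(N_W))`, `k ≥ 2`,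
  with arithmetic-Frobenius characteristic polynomial `X² − ι(a_ℓ(g))X + ℓ^{k−1}` at `ℓ ∤ N_W p`
  (the shape of `OrdinaryNewformDatum.charpoly`); and the point of `W`: `specW : I →+* ℚ̄_p`,
  `ℤ_p`-linear and over `X ↦ 0`, at which `ρ` becomes `T_p E` — `GL₂(specW) ∘ ρ` is conjugate, by a
  matrix in `GL₂(ℤ̄_p)`, to the matrix representation of `W.galoisRepTate p` in a `ℤ_p`-basis of
  `W.tateModule p`. CONVENTION: the `Λ`-algebra structure of `I` is normalised so that the weight-`k`
  arithmetic points of `Λ` are `X ↦ (1+p)^{k−2} − 1` (the tree's `x_k` of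
  `TwoVariablePadicLFunctionProofs`), the point of `f_E` being `X ↦ 0`.
* (vi) residual representation: `ρ mod 𝔪_𝕀 ≅ E[p] ⊗ 𝔽` — in the frame, `ρ(σ) mod 𝔪` is conjugate
  by a matrix in `GL₂(𝔽)` to the matrix of `σ` on `E[p] = W.geomTorsion p` in an `𝔽_p`-basis.

## What this file is NOT

No existence statement, no big-image theorem (Hida 2013/2015, Lang 2016, CLM Thm. 1.2), no
`Λ`-adic forms or Hecke algebras, no two-variable Selmer / `p`-adic `L` objects (D-Λ2, a separate
request), no claim that `𝔲^±` are ideals (Pink; they are additive subgroups here, proved).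

## References

* H. Hida, *Galois representations into `GL₂(ℤ_p[[X]])` attached to ordinary cusp forms*, Invent.
  Math. 85 (1986) 545–613, §2, Thm. 2.1, pp. 558–560. [Hida1986]
* A. Conti, J. Lang, A. Medvedovsky, *Big images of two-dimensional pseudorepresentations*, Math.
  Ann. 385 (2023) (arXiv:1904.10519), §2.3 (`Γ_A(𝔞)`), §2.4 (Pink–Lie algebras, `SR¹`, `Γ`),
  Prop. 6.6. [ContiLangMedvedovsky2023]
* T. Ochiai, *Euler system for Galois deformations*, Ann. Inst. Fourier 55 (2005), Def. 2.3 (Im)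
  (p. 123). [Ochiai2005]
* A. Wiles, Invent. Math. 94 (1988), Thm. 2.2. [Wiles1988]
* B. Mazur, A. Wiles, Compositio Math. 59 (1986). [MazurWiles1986]
-/

noncomputable section

open scoped Classical MatrixGroups ModularForm NumberField

open CongruenceSubgroup IsDedekindDomain Field UpperHalfPlane
open Literature.NumberTheory.GaloisRepresentations
open Literature.NumberTheory.EllipticCurves.ModularForms
open Literature.NumberTheory.EllipticCurves.GreenbergSelmer

namespace Literature.NumberTheory.EllipticCurves

/-! ## §1 Congruence kernel, Pink's group `Γ`, unipotent levels (CLM §2.3–2.4; Ochiai (Im)) -/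

namespace HidaFamily

section Unipotent

variable {A : Type*} [CommRing A]

/-- The upper unipotent matrix `U⁺(b) = (1 b; 0 1) ∈ GL₂(A)` (Ochiai 2005, Def. 2.3 (Im) 1): "the
image of `τ` … has a presentation `(1 P_τ; 0 1)` under certain choice of basis").
[cite: Ochiai2005, Def. 2.3 (p. 123)] -/
def unipUpper (b : A) : GL (Fin 2) A :=
  ⟨!![1, b; 0, 1], !![1, -b; 0, 1],
    by ext i j; fin_cases i <;> fin_cases j <;> simp,
    by ext i j; fin_cases i <;> fin_cases j <;> simp⟩

/-- The lower unipotent matrix `U⁻(c) = (1 0; c 1) ∈ GL₂(A)`. [cite: Ochiai2005, Def. 2.3 (p. 123)] -/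
def unipLower (c : A) : GL (Fin 2) A :=
  ⟨!![1, 0; c, 1], !![1, 0; -c, 1],
    by ext i j; fin_cases i <;> fin_cases j <;> simp,
    by ext i j; fin_cases i <;> fin_cases j <;> simp⟩

/-- Unfolding `unipUpper`. [cite: Ochiai2005, Def. 2.3 (p. 123)] -/
@[simp]
theorem coe_unipUpper (b : A) : ((unipUpper b : GL (Fin 2) A) : Matrix (Fin 2) (Fin 2) A) = !![1, b; 0, 1] :=
  rfl

/-- Unfolding `unipLower`. [cite: Ochiai2005, Def. 2.3 (p. 123)] -/
@[simp]
theorem coe_unipLower (c : A) : ((unipLower c : GL (Fin 2) A) : Matrix (Fin 2) (Fin 2) A) = !![1, 0; c, 1] :=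
  rfl

/-- `U⁺(b)` is Mathlib's transvection `1 + b E₁₂`. [cite: Ochiai2005, Def. 2.3 (p. 123)] -/
theorem coe_unipUpper_eq_transvection (b : A) :
    ((unipUpper b : GL (Fin 2) A) : Matrix (Fin 2) (Fin 2) A) = Matrix.transvection 0 1 b := by
  ext i j
  fin_cases i <;> fin_cases j <;> simp [Matrix.transvection]

/-- `U⁻(c)` is Mathlib's transvection `1 + c E₂₁`. [cite: Ochiai2005, Def. 2.3 (p. 123)] -/
theorem coe_unipLower_eq_transvection (c : A) :
    ((unipLower c : GL (Fin 2) A) : Matrix (Fin 2) (Fin 2) A) = Matrix.transvection 1 0 c := by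
  ext i j
  fin_cases i <;> fin_cases j <;> simp [Matrix.transvection]

/-- `U⁺(0) = 1`. [cite: Ochiai2005, Def. 2.3 (p. 123)] -/
@[simp]
theorem unipUpper_zero : unipUpper (0 : A) = 1 := by
  ext i j
  fin_cases i <;> fin_cases j <;> simp

/-- `U⁻(0) = 1`. [cite: Ochiai2005, Def. 2.3 (p. 123)] -/
@[simp]
theorem unipLower_zero : unipLower (0 : A) = 1 := by
  ext i j
  fin_cases i <;> fin_cases j <;> simp

/-- `U⁺(b + b') = U⁺(b) U⁺(b')`. [cite: Ochiai2005, Def. 2.3 (p. 123)] -/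
theorem unipUpper_add (b b' : A) : unipUpper (b + b') = unipUpper b * unipUpper b' := by
  ext i j
  fin_cases i <;> fin_cases j <;> simp [Matrix.mul_apply, Fin.sum_univ_two, add_comm]

/-- `U⁻(c + c') = U⁻(c) U⁻(c')`. [cite: Ochiai2005, Def. 2.3 (p. 123)] -/
theorem unipLower_add (c c' : A) : unipLower (c + c') = unipLower c * unipLower c' := by
  ext i j
  fin_cases i <;> fin_cases j <;> simp [Matrix.mul_apply, Fin.sum_univ_two, add_comm]

/-- `U⁺(−b) = U⁺(b)⁻¹`. [cite: Ochiai2005, Def. 2.3 (p. 123)] -/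
theorem unipUpper_neg (b : A) : unipUpper (-b) = (unipUpper b)⁻¹ := by
  rw [eq_inv_iff_mul_eq_one, ← unipUpper_add, neg_add_cancel, unipUpper_zero]

/-- `U⁻(−c) = U⁻(c)⁻¹`. [cite: Ochiai2005, Def. 2.3 (p. 123)] -/
theorem unipLower_neg (c : A) : unipLower (-c) = (unipLower c)⁻¹ := by
  rw [eq_inv_iff_mul_eq_one, ← unipLower_add, neg_add_cancel, unipLower_zero]

/-- `det U⁺(b) = 1`. [cite: Ochiai2005, Def. 2.3 (p. 123)] -/
@[simp]
theorem det_unipUpper (b : A) : Matrix.GeneralLinearGroup.det (unipUpper b) = 1 := by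
  ext
  simp [Matrix.det_fin_two]

/-- `det U⁻(c) = 1`. [cite: Ochiai2005, Def. 2.3 (p. 123)] -/
@[simp]
theorem det_unipLower (c : A) : Matrix.GeneralLinearGroup.det (unipLower c) = 1 := by
  ext
  simp [Matrix.det_fin_two]

/-- **The upper unipotent levels of a subgroup `Γ ≤ GL₂(A)`**: `𝔲⁺(Γ) = {b ∈ A : U⁺(b) ∈ Γ}`, an
additive subgroup of `A` (the "levels" of Ochiai's `τ`; Pink/CLM §2.4: the upper entry module of
`Γ`). [cite: ContiLangMedvedovsky2023, §2.4] [cite: Ochiai2005, Def. 2.3 (p. 123)] -/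
def upperLevels (Γ : Subgroup (GL (Fin 2) A)) : AddSubgroup A where
  carrier := {b | unipUpper b ∈ Γ}
  zero_mem' := by simp [Γ.one_mem]
  add_mem' {b b'} hb hb' := by
    simp only [Set.mem_setOf_eq] at hb hb' ⊢
    rw [unipUpper_add]
    exact Γ.mul_mem hb hb'
  neg_mem' {b} hb := by
    simp only [Set.mem_setOf_eq] at hb ⊢
    rw [unipUpper_neg]
    exact Γ.inv_mem hb

/-- **The lower unipotent levels** `𝔲⁻(Γ) = {c ∈ A : U⁻(c) ∈ Γ}`, an additive subgroup of `A`.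
[cite: ContiLangMedvedovsky2023, §2.4] [cite: Ochiai2005, Def. 2.3 (p. 123)] -/
def lowerLevels (Γ : Subgroup (GL (Fin 2) A)) : AddSubgroup A where
  carrier := {c | unipLower c ∈ Γ}
  zero_mem' := by simp [Γ.one_mem]
  add_mem' {c c'} hc hc' := by
    simp only [Set.mem_setOf_eq] at hc hc' ⊢
    rw [unipLower_add]
    exact Γ.mul_mem hc hc'
  neg_mem' {c} hc := by
    simp only [Set.mem_setOf_eq] at hc ⊢
    rw [unipLower_neg]
    exact Γ.inv_mem hc

/-- Unfolding `upperLevels`. [cite: ContiLangMedvedovsky2023, §2.4 (p. 10–11)] -/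
@[simp]
theorem mem_upperLevels_iff (Γ : Subgroup (GL (Fin 2) A)) (b : A) :
    b ∈ upperLevels Γ ↔ unipUpper b ∈ Γ :=
  Iff.rfl

/-- Unfolding `lowerLevels`. [cite: ContiLangMedvedovsky2023, §2.4 (p. 10–11)] -/
@[simp]
theorem mem_lowerLevels_iff (Γ : Subgroup (GL (Fin 2) A)) (c : A) :
    c ∈ lowerLevels Γ ↔ unipLower c ∈ Γ :=
  Iff.rfl

/-- The levels are monotone in `Γ`. [cite: ContiLangMedvedovsky2023, §2.4 (p. 10–11)] -/
theorem upperLevels_mono {Γ Γ' : Subgroup (GL (Fin 2) A)} (h : Γ ≤ Γ') :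
    upperLevels Γ ≤ upperLevels Γ' :=
  fun _ hb => h hb

/-- The levels are monotone in `Γ`. [cite: ContiLangMedvedovsky2023, §2.4 (p. 10–11)] -/
theorem lowerLevels_mono {Γ Γ' : Subgroup (GL (Fin 2) A)} (h : Γ ≤ Γ') :
    lowerLevels Γ ≤ lowerLevels Γ' :=
  fun _ hc => h hc

/-- **Level supply at an ideal `P`** (ROW 45 (FH1) at `P`, the form filed with
`defn-HidaFamilyGaloisRepDatum`): it is NOT the case that `P` contains all upper AND all lower
unipotent levels of `Γ` — equivalently (`levelSupplyAt_iff`) some `U⁺(b) ∈ Γ` or some `U⁻(c) ∈ Γ`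
has `b ∉ P` resp. `c ∉ P`, i.e. `Γ` contains a unipotent element (in the given basis, up to swapping
the two basis vectors) whose level is prime to `P`: Ochiai's `τ` of (Im) 1) with `P_τ ∉ P`.
[cite: Ochiai2005, Def. 2.3 (p. 123)] -/
def LevelSupplyAt (Γ : Subgroup (GL (Fin 2) A)) (P : Ideal A) : Prop :=
  ¬ ((upperLevels Γ : Set A) ⊆ P ∧ (lowerLevels Γ : Set A) ⊆ P)

/-- **Two-sided level supply at `P`** (the shape sketch `USS4ShapeSketch.LevelSupplyAt` of the
consumer cell): there are `b, c ∉ P` with `U⁺(b) ∈ Γ` AND `U⁻(c) ∈ Γ`. Implies `LevelSupplyAt`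
(`TwoSidedLevelSupplyAt.levelSupplyAt`). [cite: Ochiai2005, Def. 2.3 (p. 123)] -/
def TwoSidedLevelSupplyAt (Γ : Subgroup (GL (Fin 2) A)) (P : Ideal A) : Prop :=
  (∃ b ∈ upperLevels Γ, b ∉ P) ∧ (∃ c ∈ lowerLevels Γ, c ∉ P)

/-- `LevelSupplyAt` unfolded: some upper level or some lower level lies outside `P`. [cite: ContiLangMedvedovsky2023, §2.4 (p. 10–11)] -/
theorem levelSupplyAt_iff (Γ : Subgroup (GL (Fin 2) A)) (P : Ideal A) :
    LevelSupplyAt Γ P ↔ (∃ b ∈ upperLevels Γ, b ∉ P) ∨ (∃ c ∈ lowerLevels Γ, c ∉ P) := by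
  simp only [LevelSupplyAt, not_and_or, Set.not_subset]
  rfl

/-- Two-sided supply implies supply. [cite: ContiLangMedvedovsky2023, §2.4 (p. 10–11)] -/
theorem TwoSidedLevelSupplyAt.levelSupplyAt {Γ : Subgroup (GL (Fin 2) A)} {P : Ideal A}
    (h : TwoSidedLevelSupplyAt Γ P) : LevelSupplyAt Γ P :=
  (levelSupplyAt_iff Γ P).2 (Or.inl h.1)

/-- There is never supply at the unit ideal. [cite: ContiLangMedvedovsky2023, §2.4 (p. 10–11)] -/
theorem not_levelSupplyAt_top (Γ : Subgroup (GL (Fin 2) A)) : ¬ LevelSupplyAt Γ ⊤ := by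
  simp [LevelSupplyAt]

/-- Supply is antitone in the ideal. [cite: ContiLangMedvedovsky2023, §2.4 (p. 10–11)] -/
theorem LevelSupplyAt.anti {Γ : Subgroup (GL (Fin 2) A)} {P Q : Ideal A} (hQP : Q ≤ P)
    (h : LevelSupplyAt Γ P) : LevelSupplyAt Γ Q := by
  rw [levelSupplyAt_iff] at h ⊢
  rcases h with ⟨b, hb, hbP⟩ | ⟨c, hc, hcP⟩
  · exact Or.inl ⟨b, hb, fun hbQ => hbP (hQP hbQ)⟩
  · exact Or.inr ⟨c, hc, fun hcQ => hcP (hQP hcQ)⟩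

/-- Supply is monotone in `Γ`. [cite: ContiLangMedvedovsky2023, §2.4 (p. 10–11)] -/
theorem LevelSupplyAt.mono {Γ Γ' : Subgroup (GL (Fin 2) A)} (hΓ : Γ ≤ Γ') {P : Ideal A}
    (h : LevelSupplyAt Γ P) : LevelSupplyAt Γ' P := by
  rw [levelSupplyAt_iff] at h ⊢
  rcases h with ⟨b, hb, hbP⟩ | ⟨c, hc, hcP⟩
  · exact Or.inl ⟨b, upperLevels_mono hΓ hb, hbP⟩
  · exact Or.inr ⟨c, lowerLevels_mono hΓ hc, hcP⟩

/-- Non-vacuity of the supply predicates: if `U⁺(1), U⁻(1) ∈ Γ` then there is two-sided supply at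
every proper ideal. [cite: ContiLangMedvedovsky2023, §2.4 (p. 10–11)] -/
theorem twoSidedLevelSupplyAt_of_one_mem {Γ : Subgroup (GL (Fin 2) A)} {P : Ideal A} (hP : P ≠ ⊤)
    (h1 : (1 : A) ∈ upperLevels Γ) (h2 : (1 : A) ∈ lowerLevels Γ) : TwoSidedLevelSupplyAt Γ P := by
  have hone : (1 : A) ∉ P := fun h => hP ((Ideal.eq_top_iff_one _).mpr h)
  exact ⟨⟨1, h1, hone⟩, ⟨1, h2, hone⟩⟩

/-- **Finite projective image** of a homomorphism `f : G → GL₂(B)`: finitely many matrices represent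
every `f(g)` up to a unit scalar (i.e. the image of `f` in `PGL₂(B)` is finite). [cite: ContiLangMedvedovsky2023, §2 Notation (p. 7, "projective image") and §1 (p. 3, "a priori small")] -/
def FiniteProjectiveImage {G : Type*} [Group G] {B : Type*} [CommRing B] (f : G →* GL (Fin 2) B) :
    Prop :=
  ∃ S : Finset (Matrix (Fin 2) (Fin 2) B), ∀ g : G, ∃ s ∈ S, ∃ u : Bˣ,
    ((f g : GL (Fin 2) B) : Matrix (Fin 2) (Fin 2) B) = (u : B) • s

end Unipotent

section Local

variable (A : Type*) [CommRing A] [IsLocalRing A]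

/-- **The congruence kernel `Γ_A(𝔪)` in `GL₂`**: the kernel of the reduction
`GL₂(A) → GL₂(A/𝔪_A)`, `𝔪_A` the maximal ideal — CLM §2.4: `R¹ = 1 + rad R` for `R = M₂(A)`
(`rad M₂(A) = M₂(𝔪_A)`); intersected with `SL₂` it is CLM §2.3's
`Γ_A(𝔪) = ker(SL₂(A) → SL₂(A/𝔪))`. [cite: ContiLangMedvedovsky2023, §2.3 and §2.4] -/
def congruenceKer : Subgroup (GL (Fin 2) A) :=
  (Matrix.GeneralLinearGroup.map (IsLocalRing.residue A)).ker

variable {A}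

/-- Membership in `Γ_A(𝔪)`: the reduction of the matrix is `1`. [cite: ContiLangMedvedovsky2023, §2.3] -/
theorem mem_congruenceKer_iff (g : GL (Fin 2) A) :
    g ∈ congruenceKer A ↔
      ((g : GL (Fin 2) A) : Matrix (Fin 2) (Fin 2) A).map (IsLocalRing.residue A) = 1 := by
  rw [congruenceKer, MonoidHom.mem_ker, ← Units.val_eq_one]
  rfl

/-- Membership in `Γ_A(𝔪)`, entrywise: `g ≡ 1 (mod 𝔪_A)` — CLM §2.3:
"`{(1+a b; c 1+d) : a, b, c, d ∈ 𝔞}`". [cite: ContiLangMedvedovsky2023, §2.3] -/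
theorem mem_congruenceKer_iff_sub_mem (g : GL (Fin 2) A) :
    g ∈ congruenceKer A ↔
      ∀ i j, ((g : GL (Fin 2) A) : Matrix (Fin 2) (Fin 2) A) i j - (1 : Matrix (Fin 2) (Fin 2) A) i j ∈
        IsLocalRing.maximalIdeal A := by
  rw [mem_congruenceKer_iff, ← Matrix.ext_iff]
  refine forall₂_congr fun i j => ?_
  rw [Matrix.map_apply, ← IsLocalRing.residue_eq_zero_iff, map_sub, sub_eq_zero]
  rcases eq_or_ne i j with rfl | hij
  · simp
  · simp [Matrix.one_apply_ne hij]

variable (A) in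
/-- **Pink's group of a subgroup `G ≤ GL₂(A)`**: `Γ(G) = G ∩ Γ_A(𝔪) ∩ SL₂(A)` — CLM §2.4 and §3.1:
`Γ_ρ := G_ρ ∩ SR¹` with `G_ρ = im ρ`, `SR¹ = {det = 1} ∩ (1 + rad R)`, the closed pro-`p` subgroup of
`SL₂(A)` to which Pink's Lie-algebra correspondence (CLM Thm. 2.20) applies.
[cite: ContiLangMedvedovsky2023, §2.4 (SR¹) and §3.1 (Γ_ρ = G_ρ ∩ SR¹)] -/
def pinkGamma (G : Subgroup (GL (Fin 2) A)) : Subgroup (GL (Fin 2) A) :=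
  G ⊓ congruenceKer A ⊓ (Matrix.GeneralLinearGroup.det : GL (Fin 2) A →* Aˣ).ker

/-- Unfolding `pinkGamma`. [cite: ContiLangMedvedovsky2023, §2.4] -/
theorem mem_pinkGamma_iff (G : Subgroup (GL (Fin 2) A)) (g : GL (Fin 2) A) :
    g ∈ pinkGamma A G ↔ g ∈ G ∧ g ∈ congruenceKer A ∧ Matrix.GeneralLinearGroup.det g = 1 := by
  simp [pinkGamma, Subgroup.mem_inf, MonoidHom.mem_ker, and_assoc]

/-- `Γ(G) ≤ G`. [cite: ContiLangMedvedovsky2023, §2.3 (p. 9) and §2.4 (p. 10–11)] -/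
theorem pinkGamma_le (G : Subgroup (GL (Fin 2) A)) : pinkGamma A G ≤ G :=
  fun _ hg => ((mem_pinkGamma_iff G _).1 hg).1

/-- `Γ(G)` is monotone in `G`. [cite: ContiLangMedvedovsky2023, §2.3 (p. 9) and §2.4 (p. 10–11)] -/
theorem pinkGamma_mono {G G' : Subgroup (GL (Fin 2) A)} (h : G ≤ G') : pinkGamma A G ≤ pinkGamma A G' :=
  fun g hg => by
    rw [mem_pinkGamma_iff] at hg ⊢
    exact ⟨h hg.1, hg.2⟩

/-- An upper unipotent `U⁺(b)` lies in the congruence kernel iff `b ∈ 𝔪_A`. [cite: ContiLangMedvedovsky2023, §2.3 (p. 9) and §2.4 (p. 10–11)] -/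
theorem unipUpper_mem_congruenceKer_iff (b : A) :
    unipUpper b ∈ congruenceKer A ↔ b ∈ IsLocalRing.maximalIdeal A := by
  rw [mem_congruenceKer_iff_sub_mem]
  constructor
  · intro h
    simpa using h 0 1
  · intro hb i j
    fin_cases i <;> fin_cases j <;> simp [hb]

/-- A lower unipotent `U⁻(c)` lies in the congruence kernel iff `c ∈ 𝔪_A`. [cite: ContiLangMedvedovsky2023, §2.3 (p. 9) and §2.4 (p. 10–11)] -/
theorem unipLower_mem_congruenceKer_iff (c : A) :
    unipLower c ∈ congruenceKer A ↔ c ∈ IsLocalRing.maximalIdeal A := by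
  rw [mem_congruenceKer_iff_sub_mem]
  constructor
  · intro h
    simpa using h 1 0
  · intro hc i j
    fin_cases i <;> fin_cases j <;> simp [hc]

/-- The levels of Pink's group lie in the maximal ideal: `𝔲⁺(Γ(G)) ⊆ 𝔪_A`. [cite: ContiLangMedvedovsky2023, §2.3 (p. 9) and §2.4 (p. 10–11)] -/
theorem upperLevels_pinkGamma_le (G : Subgroup (GL (Fin 2) A)) :
    (upperLevels (pinkGamma A G) : Set A) ⊆ IsLocalRing.maximalIdeal A := fun b hb => by
  have hb' := (mem_pinkGamma_iff G _).1 hb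
  exact (unipUpper_mem_congruenceKer_iff b).1 hb'.2.1

/-- `𝔲⁻(Γ(G)) ⊆ 𝔪_A`. [cite: ContiLangMedvedovsky2023, §2.3 (p. 9) and §2.4 (p. 10–11)] -/
theorem lowerLevels_pinkGamma_le (G : Subgroup (GL (Fin 2) A)) :
    (lowerLevels (pinkGamma A G) : Set A) ⊆ IsLocalRing.maximalIdeal A := fun c hc => by
  have hc' := (mem_pinkGamma_iff G _).1 hc
  exact (unipLower_mem_congruenceKer_iff c).1 hc'.2.1

/-- Hence there is no level supply of `Γ(G)` at the maximal ideal itself (supply is a condition on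
the height-one primes `P ⊊ 𝔪`). [cite: ContiLangMedvedovsky2023, §2.3 (p. 9) and §2.4 (p. 10–11)] -/
theorem not_levelSupplyAt_pinkGamma_maximalIdeal (G : Subgroup (GL (Fin 2) A)) :
    ¬ LevelSupplyAt (pinkGamma A G) (IsLocalRing.maximalIdeal A) := by
  simp only [LevelSupplyAt, not_not]
  exact ⟨upperLevels_pinkGamma_le G, lowerLevels_pinkGamma_le G⟩

/-- Membership of an upper unipotent in Pink's group: `U⁺(b) ∈ Γ(G) ↔ U⁺(b) ∈ G ∧ b ∈ 𝔪_A`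
(its determinant is `1`). [cite: ContiLangMedvedovsky2023, §2.3 (p. 9) and §2.4 (p. 10–11)] -/
theorem unipUpper_mem_pinkGamma_iff (G : Subgroup (GL (Fin 2) A)) (b : A) :
    unipUpper b ∈ pinkGamma A G ↔ unipUpper b ∈ G ∧ b ∈ IsLocalRing.maximalIdeal A := by
  rw [mem_pinkGamma_iff, unipUpper_mem_congruenceKer_iff, det_unipUpper]
  simp

/-- `U⁻(c) ∈ Γ(G) ↔ U⁻(c) ∈ G ∧ c ∈ 𝔪_A`. [cite: ContiLangMedvedovsky2023, §2.3 (p. 9) and §2.4 (p. 10–11)] -/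
theorem unipLower_mem_pinkGamma_iff (G : Subgroup (GL (Fin 2) A)) (c : A) :
    unipLower c ∈ pinkGamma A G ↔ unipLower c ∈ G ∧ c ∈ IsLocalRing.maximalIdeal A := by
  rw [mem_pinkGamma_iff, unipLower_mem_congruenceKer_iff, det_unipLower]
  simp

end Local

end HidaFamily

/-! ## §2 The datum -/

section Datum

/-- The **regime** of `defn-HidaFamilyGaloisRepDatum` (where a datum is intended to exist): `E/ℚ`
non-CM, `p ≥ 5` (Hida 1986, Introduction: "Assume throughout the paper that `p ≥ 5`"), good
ORDINARY reduction at `p` (`p ∤ a_p(E)`), and `E[p]` irreducible (so that `ρ_𝓕` is realised on a free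
`𝕀`-lattice and `ρ̄_{E,p}|_{G_{ℚ_p}}` is `p`-distinguished). A predicate on `(W, p)`; used only to
document scope (the existence fact is not vendored in this file). [cite: Hida1986, Introduction (p. 545) and Thm. 2.1 (p. 559)] -/
def HidaFamilyGaloisRepDatum.Regime (W : WeierstrassCurve ℚ) [W.IsGloballyMinimal] (p : ℕ)
    [Fact p.Prime] : Prop :=
  ¬ W.HasCM ∧ 5 ≤ p ∧ W.HasGoodReductionAtPrime p ∧ ¬ (p : ℤ) ∣ W.frobeniusTrace p ∧
    W.HasIrreducibleModPGaloisRep p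

/-- **The big ordinary Galois representation of the Hida family through `W` at `p`, over the
coefficient domain `I` — an interface (D-Λ1).** For a Weierstrass curve `W/ℚ`, a prime `p` and a
topological local domain `I` which is an algebra over `Λ = IwasawaAlgebra p = ℤ_p⟦X⟧`, a datum
consists of (hypothesis fields; see the module docstring for the printed sources of each):
* (i) `I` is module-finite over `Λ`, its residue field `𝔽 = I/𝔪_I` is finite of characteristic `p`,
  and its topology is the `𝔪_I`-adic one (Hida 1986, p. 558: `𝓘(𝒦)` "the integral closure of `Λ_K`
  in `𝒦`"; CLM §1: "a domain that is finite over `Λ`", a "local pro-`p` ring");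
* (ii) `rho : Γ_ℚ →ₜ* GL₂(I)` continuous, unramified at every finite place `v` of residue
  characteristic `ℓ ∤ N_W·p`, `N_W = W.conductorNorm ℤ` (Hida 1986, Thm. 2.1 (2.2b): "`π` is
  unramified outside `Np`");
* (iii) `det ∘ rho = detChar ∘ χ_p` for an injective continuous `detChar : ℤ_p^× →ₜ* I^×`, `χ_p` the
  `p`-adic cyclotomic character `GaloisRep.cyclotomicCharacter ℚ p` (Hida 1986, p. 560:
  "`det(π)` coincides with the character `ψχ⁻¹·ι`");
* (iv) ORDINARITY in the given frame `(e₁, e₂)` of `I²`, at every place `v` of `ℚ` above `p`, along the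
  tree's fixed decomposition group `absGaloisRestrict ℚ ℚ_v : Γ_{ℚ_v} → Γ_ℚ` and inertia group
  `absInertia ℚ_v`: `rho(σ)` is upper triangular for `σ ∈ D_v` (lower-left entry `0`), the rank-one
  quotient is unramified (lower-right entry `1` on `I_v`), and the upper-left inertia character
  `θ = ε|_{I_v}` has infinite order (some `σ ∈ I_v` with `rho(σ)₁₁` of infinite order) (CLM Prop. 6.6,
  proof: "`ρ|_{G_{ℚ_p}} = (ε ∗; 0 δ)` with `δ` unramified and `ε(g₀) = (1+X ∗; 0 1)` for some `g₀` in the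
  inertia subgroup at `p`"; Wiles 1988, Thm. 2.2);
* (v) SPECIALISATIONS: a ring homomorphism `specW : I →+* ℚ̄_p` with values in `ℤ̄_p`, `ℤ_p`-linear
  and lying over the point `X ↦ 0` of `Λ` (CONVENTION: weight-`k` points of `Λ` are
  `X ↦ (1+p)^{k−2} − 1`), at which `rho` becomes the `p`-adic Tate module of `W`: for some `ℤ_p`-basis
  `b` of `W.tateModule p` and some `P ∈ GL₂(ℤ̄_p)`, `specW(rho σ) = P·[W.galoisRepTate p σ]_b·P⁻¹` for
  all `σ`; and a set `arithPoints` of ring homomorphisms `I →+* ℚ̄_p`, ZARISKI DENSE (no non-zero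
  element of the domain `I` is killed by all of them), each with values in `ℤ̄_p`, lying over an
  arithmetic point `X ↦ (1+p)^{k−2} − 1` of `Λ` and carrying a `p`-ordinary newform
  `g ∈ S_k(Γ₀(N_W))`, `k ≥ 2`, `ι : K_g → ℚ̄_p`, `|ι(a_p(g))|_p = 1`, such that at every `ℓ ∤ N_W p`
  the arithmetic Frobenius has characteristic polynomial `P_ℓ ∈ I[X]` with
  `φ(P_ℓ) = X² − ι(a_ℓ(g))X + ℓ^{k−1}` (Hida 1986, Thm. 2.1 (2.2c), (2.1b), and p. 559: "The subset … of
  the points obtained from ordinary forms is dense under the Zariski topology");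
* (vi) RESIDUAL representation: `rho mod 𝔪_I` is conjugate in `GL₂(𝔽)` to `E[p] ⊗ 𝔽`, i.e. to the
  matrices of `Γ_ℚ` acting on `E[p] = W.geomTorsion p` in some `𝔽_p`-basis `(Fin 2 → ZMod p) ≃+ E[p]`.
A hypothesis structure: NOTHING is asserted — in particular not its existence (Hida 1986 Thm. 2.1
with Mazur–Wiles 1986 / Wiles 1988 Thm. 2.2, in the regime `HidaFamilyGaloisRepDatum.Regime W p`),
which is a separate cite fact; statements take `D : HidaFamilyGaloisRepDatum W p I` as a binder over
`∀ (I : Type) [CommRing I] [IsDomain I] [IsLocalRing I] [TopologicalSpace I] [IsTopologicalRing I]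
[Algebra (IwasawaAlgebra p) I]`. No instance is declared.
[cite: Hida1986, Thm. 2.1 (p. 559) and p. 560] [cite: ContiLangMedvedovsky2023, §1 (p. 4) and Prop. 6.6 (proof)] [cite: Wiles1988, Thm. 2.2] -/
structure HidaFamilyGaloisRepDatum (W : WeierstrassCurve ℚ) (p : ℕ) [Fact p.Prime]
    (I : Type) [CommRing I] [IsDomain I] [IsLocalRing I] [TopologicalSpace I] [IsTopologicalRing I]
    [Algebra (IwasawaAlgebra p) I] where
  /-- (i) `I` is module-finite over `Λ = ℤ_p⟦X⟧`. -/
  moduleFinite : Module.Finite (IwasawaAlgebra p) I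
  /-- (i) the residue field `𝔽 = I/𝔪_I` is finite … -/
  finite_residueField : Finite (IsLocalRing.ResidueField I)
  /-- (i) … of characteristic `p`. -/
  charP_residueField : CharP (IsLocalRing.ResidueField I) p
  /-- (ii) the topology of `I` is the `𝔪_I`-adic topology (so `rho` below is `𝔪_I`-adically continuous). -/
  isAdic : IsAdic (IsLocalRing.maximalIdeal I)
  /-- (ii) the big Galois representation `ρ_𝓕 : Γ_ℚ →ₜ* GL₂(I)` in its ordinary frame. -/
  rho : FramedGaloisRep ℚ I 2
  /-- (ii) `ρ_𝓕` is unramified at every finite place of residue characteristic `ℓ ∤ N_W p`. -/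
  isUnramifiedAt : ∀ v : HeightOneSpectrum (𝓞 ℚ),
    ¬ ((Rat.HeightOneSpectrum.primesEquiv v : Nat.Primes) : ℕ) ∣ W.conductorNorm ℤ →
    ((Rat.HeightOneSpectrum.primesEquiv v : Nat.Primes) : ℕ) ≠ p → rho.IsUnramifiedAt v
  /-- (iii) the determinant character `ψ : ℤ_p^× →ₜ* I^×` … -/
  detChar : ℤ_[p]ˣ →ₜ* Iˣ
  /-- (iii) … is injective … -/
  detChar_injective : Function.Injective detChar
  /-- (iii) … and `det ρ_𝓕 = ψ ∘ χ_p`. -/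
  det_eq : ∀ σ : absoluteGaloisGroup ℚ,
    FramedRep.det rho σ = detChar (GaloisRep.cyclotomicCharacter ℚ p σ)
  /-- (iv) ordinary at `v ∣ p`: `ρ_𝓕(σ)` is upper triangular for `σ` in the decomposition group. -/
  apply_one_zero_eq_zero : ∀ v : HeightOneSpectrum (𝓞 ℚ), ((p : ℕ) : 𝓞 ℚ) ∈ v.asIdeal →
    ∀ σ : absoluteGaloisGroup (v.adicCompletion ℚ),
      ((rho (absGaloisRestrict ℚ (v.adicCompletion ℚ) σ) : GL (Fin 2) I) :
        Matrix (Fin 2) (Fin 2) I) 1 0 = 0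
  /-- (iv) the rank-one quotient is unramified: the lower-right entry is `1` on inertia. -/
  apply_one_one_eq_one : ∀ v : HeightOneSpectrum (𝓞 ℚ), ((p : ℕ) : 𝓞 ℚ) ∈ v.asIdeal →
    ∀ σ ∈ absInertia (v.adicCompletion ℚ),
      ((rho (absGaloisRestrict ℚ (v.adicCompletion ℚ) σ) : GL (Fin 2) I) :
        Matrix (Fin 2) (Fin 2) I) 1 1 = 1
  /-- (iv) the upper-left inertia character `θ` has infinite order. -/
  exists_not_isOfFinOrder : ∀ v : HeightOneSpectrum (𝓞 ℚ), ((p : ℕ) : 𝓞 ℚ) ∈ v.asIdeal →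
    ∃ σ ∈ absInertia (v.adicCompletion ℚ),
      ¬ IsOfFinOrder (((rho (absGaloisRestrict ℚ (v.adicCompletion ℚ) σ) : GL (Fin 2) I) :
        Matrix (Fin 2) (Fin 2) I) 0 0)
  /-- (v) the point of `W`: a ring homomorphism `I → ℚ̄_p` … -/
  specW : I →+* PadicAlgCl p
  /-- (v) … with values in `ℤ̄_p` … -/
  norm_specW_le_one : ∀ x : I, ‖specW x‖ ≤ 1
  /-- (v) … `ℤ_p`-linear and lying over the point `X ↦ 0` of `Λ` (the weight-`2` point in the
  convention `x_k = (1+p)^{k−2} − 1`). -/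
  specW_algebraMap : ∀ f : IwasawaAlgebra p,
    specW (algebraMap (IwasawaAlgebra p) I f) =
      algebraMap ℚ_[p] (PadicAlgCl p) ((PowerSeries.constantCoeff f : ℤ_[p]) : ℚ_[p])
  /-- (v) `GL₂(specW) ∘ ρ_𝓕 ≅ T_p E` integrally: conjugate by some `P ∈ GL₂(ℤ̄_p)` to the matrices of
  `W.galoisRepTate p` in some `ℤ_p`-basis of `W.tateModule p`. -/
  exists_conj_galoisRepTate :
    ∃ (b : Module.Basis (Fin 2) ℤ_[p] (W.tateModule p)) (P : GL (Fin 2) (PadicAlgCl p)),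
      (∀ i j, ‖((P : GL (Fin 2) (PadicAlgCl p)) : Matrix (Fin 2) (Fin 2) (PadicAlgCl p)) i j‖ ≤ 1) ∧
      (∀ i j, ‖((P⁻¹ : GL (Fin 2) (PadicAlgCl p)) : Matrix (Fin 2) (Fin 2) (PadicAlgCl p)) i j‖ ≤ 1) ∧
      ∀ σ : absoluteGaloisGroup ℚ,
        ((rho σ : GL (Fin 2) I) : Matrix (Fin 2) (Fin 2) I).map specW =
          ((P : GL (Fin 2) (PadicAlgCl p)) : Matrix (Fin 2) (Fin 2) (PadicAlgCl p)) *
            (LinearMap.toMatrix b b (W.galoisRepTate p σ)).map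
              (fun x : ℤ_[p] => algebraMap ℚ_[p] (PadicAlgCl p) (x : ℚ_[p])) *
            ((P⁻¹ : GL (Fin 2) (PadicAlgCl p)) : Matrix (Fin 2) (Fin 2) (PadicAlgCl p))
  /-- (v) the arithmetic points used (a set of ring homomorphisms `I → ℚ̄_p`) … -/
  arithPoints : Set (I →+* PadicAlgCl p)
  /-- (v) … Zariski dense in `Spec I` (`I` a domain: no non-zero element dies at all of them) … -/
  dense_arithPoints : ∀ x : I, x ≠ 0 → ∃ φ ∈ arithPoints, φ x ≠ 0
  /-- (v) … each integral-valued, over an arithmetic point `X ↦ (1+p)^{k−2} − 1` of `Λ`, and CLASSICAL: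
  `φ ∘ ρ_𝓕` has the Frobenius characteristic polynomials `X² − ι(a_ℓ(g))X + ℓ^{k−1}` (`ℓ ∤ N_W p`) of a
  `p`-ordinary newform `g ∈ S_k(Γ₀(N_W))`, `k ≥ 2`, `p`-adically embedded by `ι`. -/
  classical_arithPoints : ∀ φ ∈ arithPoints, (∀ x : I, ‖φ x‖ ≤ 1) ∧
    ∃ (k : ℤ) (g : CuspForm (Gamma0 (W.conductorNorm ℤ)) k) (ι : coeffField g →+* PadicAlgCl p),
      2 ≤ k ∧ (∀ [NeZero (W.conductorNorm ℤ)], IsNewform0 g) ∧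
      ‖ι ⟨(qExpansion 1 ⇑g).coeff p, coeff_mem_coeffField g p⟩‖ = 1 ∧
      φ (algebraMap (IwasawaAlgebra p) I PowerSeries.X) =
        algebraMap ℚ_[p] (PadicAlgCl p) ((((1 + p : ℤ_[p]) ^ (k - 2).toNat - 1 : ℤ_[p])) : ℚ_[p]) ∧
      ∀ v : HeightOneSpectrum (𝓞 ℚ),
        ¬ ((Rat.HeightOneSpectrum.primesEquiv v : Nat.Primes) : ℕ) ∣ W.conductorNorm ℤ →
        ((Rat.HeightOneSpectrum.primesEquiv v : Nat.Primes) : ℕ) ≠ p →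
        ∃ Pv : Polynomial I,
          Pv.map φ =
            Polynomial.X ^ 2
              - Polynomial.C (ι ⟨(qExpansion 1 ⇑g).coeff
                  ((Rat.HeightOneSpectrum.primesEquiv v : Nat.Primes) : ℕ),
                  coeff_mem_coeffField g _⟩) * Polynomial.X
              + Polynomial.C ((((Rat.HeightOneSpectrum.primesEquiv v : Nat.Primes) : ℕ) :
                  PadicAlgCl p) ^ (k - 1).toNat) ∧
          rho.HasFrobCharpolyAt v Pv
  /-- (vi) `ρ_𝓕 mod 𝔪_I ≅ E[p] ⊗ 𝔽`: conjugate in `GL₂(𝔽)` to the matrices of `Γ_ℚ` on `E[p]` in an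
  `𝔽_p`-basis. -/
  exists_conj_residual :
    ∃ (e : (Fin 2 → ZMod p) ≃+ W.geomTorsion (p : ℤ)) (P : GL (Fin 2) (IsLocalRing.ResidueField I)),
      ∀ σ : absoluteGaloisGroup ℚ,
        ((rho σ : GL (Fin 2) I) : Matrix (Fin 2) (Fin 2) I).map (IsLocalRing.residue I) =
          ((P : GL (Fin 2) (IsLocalRing.ResidueField I)) :
              Matrix (Fin 2) (Fin 2) (IsLocalRing.ResidueField I)) *
            Matrix.of (fun i j : Fin 2 =>
              ((e.symm (σ • e (Pi.single j 1)) i : ZMod p).cast : IsLocalRing.ResidueField I)) *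
            ((P⁻¹ : GL (Fin 2) (IsLocalRing.ResidueField I)) :
              Matrix (Fin 2) (Fin 2) (IsLocalRing.ResidueField I))

end Datum

/-! ## §3 Derived objects of a datum: Pink's `Γ`, the levels `𝔲^±`, supply, reductions mod `P`,
the diagonal characters at `p` and the ordinary filtration (proved API) -/

namespace HidaFamilyGaloisRepDatum

section Lines

variable {I : Type} [CommRing I]

/-- The height-one primes of `I` (Hida 1986, p. 559: "We say a prime ideal `P` of `𝓘(𝒦)` a prime divisor
if `P` is of height `1`"). [cite: Hida1986, p. 559] -/
def heightOnePrimes (I : Type) [CommRing I] : Set (Ideal I) :=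
  {P | P.IsPrime ∧ P.height = 1}

/-- Unfolding `heightOnePrimes`. [cite: Hida1986, p. 559] -/
theorem mem_heightOnePrimes_iff (P : Ideal I) : P ∈ heightOnePrimes I ↔ P.IsPrime ∧ P.height = 1 :=
  Iff.rfl

/-- **The ordinary line `I·e₁ ≤ I²`** of the frame. [cite: ContiLangMedvedovsky2023, Prop. 6.6 (proof)] -/
def plusLine (I : Type) [CommRing I] : Submodule I (Fin 2 → I) :=
  I ∙ (Pi.single 0 1 : Fin 2 → I)

/-- Membership in the ordinary line: the second coordinate vanishes. [cite: ContiLangMedvedovsky2023, Prop. 6.6 (proof, p. 39)] -/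
theorem mem_plusLine_iff (y : Fin 2 → I) : y ∈ plusLine I ↔ y 1 = 0 := by
  rw [plusLine, Submodule.mem_span_singleton]
  constructor
  · rintro ⟨a, rfl⟩
    simp
  · intro hy
    refine ⟨y 0, ?_⟩
    ext i
    fin_cases i <;> simp [hy]

/-- The complementary line `I·e₂`. [cite: ContiLangMedvedovsky2023, Prop. 6.6 (proof, p. 39)] -/
def minusLine (I : Type) [CommRing I] : Submodule I (Fin 2 → I) :=
  I ∙ (Pi.single 1 1 : Fin 2 → I)

/-- Membership in `I·e₂`: the first coordinate vanishes. [cite: ContiLangMedvedovsky2023, Prop. 6.6 (proof, p. 39)] -/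
theorem mem_minusLine_iff (y : Fin 2 → I) : y ∈ minusLine I ↔ y 0 = 0 := by
  rw [minusLine, Submodule.mem_span_singleton]
  constructor
  · rintro ⟨a, rfl⟩
    simp
  · intro hy
    refine ⟨y 1, ?_⟩
    ext i
    fin_cases i <;> simp [hy]

/-- `I² = I·e₁ ⊕ I·e₂`. [cite: ContiLangMedvedovsky2023, Prop. 6.6 (proof, p. 39)] -/
theorem isCompl_plusLine_minusLine : IsCompl (plusLine I) (minusLine I) := by
  refine IsCompl.of_eq ?_ ?_
  · rw [Submodule.eq_bot_iff]
    intro y hy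
    rw [Submodule.mem_inf, mem_plusLine_iff, mem_minusLine_iff] at hy
    ext i
    fin_cases i
    · simpa using hy.2
    · simpa using hy.1
  · rw [Submodule.eq_top_iff']
    intro y
    rw [Submodule.mem_sup]
    refine ⟨y 0 • (Pi.single 0 1 : Fin 2 → I), ?_, y 1 • (Pi.single 1 1 : Fin 2 → I), ?_, ?_⟩
    · rw [mem_plusLine_iff]; simp
    · rw [mem_minusLine_iff]; simp
    · ext i
      fin_cases i <;> simp

/-- The ordinary line is free of rank one. [cite: ContiLangMedvedovsky2023, Prop. 6.6 (proof, p. 39)] -/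
theorem finrank_plusLine [IsDomain I] : Module.finrank I (plusLine I) = 1 := by
  have h0 : (Pi.single 0 1 : Fin 2 → I) ≠ 0 := fun h => by simpa using congr_fun h 0
  rw [plusLine, ← (LinearEquiv.toSpanNonzeroSingleton I (Fin 2 → I) _ h0).finrank_eq, Module.finrank_self]

end Lines

variable {W : WeierstrassCurve ℚ} {p : ℕ} [Fact p.Prime] {I : Type} [CommRing I] [IsDomain I]
  [IsLocalRing I] [TopologicalSpace I] [IsTopologicalRing I] [Algebra (IwasawaAlgebra p) I]
  (D : HidaFamilyGaloisRepDatum W p I)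

/-! ### The determinant and `G^cyc = Gal(ℚ̄/ℚ(μ_{p^∞}))` -/

/-- `det ρ_𝓕(σ) = 1 ↔ χ_p(σ) = 1`, i.e. `↔ σ ∈ G^cyc = Gal(ℚ̄/ℚ(μ_{p^∞}))` (the kernel of the cyclotomic
character, the tree's `Literature.NumberTheory.PAdicHodge.Sen.kerCyclotomic ℚ p`) — from (iii) and the
injectivity of `ψ` (US-S4 (o4)). [cite: Hida1986, p. 560] -/
theorem det_rho_eq_one_iff (σ : absoluteGaloisGroup ℚ) :
    FramedRep.det D.rho σ = 1 ↔ GaloisRep.cyclotomicCharacter ℚ p σ = 1 := by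
  rw [D.det_eq]
  refine ⟨fun h => D.detChar_injective ?_, fun h => by rw [h, map_one]⟩
  rw [h, map_one]

/-- The same, with the kernel of `χ_p` as a subgroup. [cite: Hida1986, p. 560] -/
theorem det_rho_eq_one_iff_mem_ker (σ : absoluteGaloisGroup ℚ) :
    Matrix.GeneralLinearGroup.det (D.rho σ) = 1 ↔
      σ ∈ (GaloisRep.cyclotomicCharacter ℚ p).toMonoidHom.ker := by
  rw [MonoidHom.mem_ker, ← FramedRep.det_apply, det_rho_eq_one_iff]
  rfl

/-! ### Pink's group `Γ` and the unipotent levels -/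

/-- `ρ_𝓕(G^cyc)`: the image of `Gal(ℚ̄/ℚ(μ_{p^∞})) = ker χ_p` under `ρ_𝓕`. [cite: Ochiai2005, Def. 2.3 (p. 123)] -/
def imageCyc : Subgroup (GL (Fin 2) I) :=
  ((GaloisRep.cyclotomicCharacter ℚ p).toMonoidHom.ker).map D.rho.toMonoidHom

/-- `ρ_𝓕(G^cyc) ≤ im ρ_𝓕`. [cite: ContiLangMedvedovsky2023, §2.3 (p. 9) and §2.4 (p. 10–11)] -/
theorem imageCyc_le_range : D.imageCyc ≤ D.rho.toMonoidHom.range :=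
  (Subgroup.map_le_range _ _)

/-- Membership in `ρ_𝓕(G^cyc)`. [cite: ContiLangMedvedovsky2023, §2.3 (p. 9) and §2.4 (p. 10–11)] -/
theorem mem_imageCyc_iff (g : GL (Fin 2) I) :
    g ∈ D.imageCyc ↔ ∃ σ : absoluteGaloisGroup ℚ, GaloisRep.cyclotomicCharacter ℚ p σ = 1 ∧ D.rho σ = g := by
  simp only [imageCyc, Subgroup.mem_map, MonoidHom.mem_ker]
  rfl

/-- **`Γ := ρ_𝓕(G_{ℚ(μ_{p^∞})}) ∩ ker(GL₂(I) → GL₂(I/𝔪_I)) ∩ SL₂(I)`** in the ordinary frame of the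
datum — Pink's group of the image (CLM `Γ_ρ = G_ρ ∩ SR¹`, here cut down to `G^cyc`, which changes
nothing by `Gamma_eq_pinkGamma_range`). [cite: ContiLangMedvedovsky2023, §2.4 and §3.1 (Γ_ρ)] -/
def Gamma : Subgroup (GL (Fin 2) I) :=
  HidaFamily.pinkGamma I D.imageCyc

/-- Unfolding `Gamma`. [cite: ContiLangMedvedovsky2023, §2.4] -/
theorem mem_Gamma_iff (g : GL (Fin 2) I) :
    g ∈ D.Gamma ↔
      (∃ σ : absoluteGaloisGroup ℚ, GaloisRep.cyclotomicCharacter ℚ p σ = 1 ∧ D.rho σ = g) ∧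
        g ∈ HidaFamily.congruenceKer I ∧ Matrix.GeneralLinearGroup.det g = 1 := by
  rw [Gamma, HidaFamily.mem_pinkGamma_iff, mem_imageCyc_iff]

/-- **`Γ = im ρ_𝓕 ∩ Γ_I(𝔪) ∩ SL₂(I)`** (CLM's `Γ_ρ`): restricting to `G^cyc` is automatic, because an
element of the image with determinant `1` comes from `σ` with `χ_p(σ) = 1` (`det_rho_eq_one_iff`;
US-S4 (o4)). [cite: ContiLangMedvedovsky2023, §3.1 (Γ_ρ = G_ρ ∩ SR¹)] -/
theorem Gamma_eq_pinkGamma_range : D.Gamma = HidaFamily.pinkGamma I D.rho.toMonoidHom.range := by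
  refine le_antisymm (HidaFamily.pinkGamma_mono D.imageCyc_le_range) fun g hg => ?_
  rw [HidaFamily.mem_pinkGamma_iff] at hg
  obtain ⟨⟨σ, rfl⟩, hker, hdet⟩ := hg
  rw [mem_Gamma_iff]
  exact ⟨⟨σ, (D.det_rho_eq_one_iff σ).1 (by rw [FramedRep.det_apply]; exact hdet), rfl⟩, hker, hdet⟩

/-- `Γ ≤ im ρ_𝓕`. [cite: ContiLangMedvedovsky2023, §2.3 (p. 9) and §2.4 (p. 10–11)] -/
theorem Gamma_le_range : D.Gamma ≤ D.rho.toMonoidHom.range :=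
  (HidaFamily.pinkGamma_le _).trans D.imageCyc_le_range

/-- **The upper unipotent levels `𝔲⁺ := {u ∈ I : (1 u; 0 1) ∈ Γ}`** of the datum (an additive subgroup
of `I`, contained in `𝔪_I`). [cite: Ochiai2005, Def. 2.3 (p. 123)] [cite: ContiLangMedvedovsky2023, §2.4] -/
def upperLevels : AddSubgroup I :=
  HidaFamily.upperLevels D.Gamma

/-- **The lower unipotent levels `𝔲⁻ := {u ∈ I : (1 0; u 1) ∈ Γ}`**. [cite: Ochiai2005, Def. 2.3 (p. 123)] [cite: ContiLangMedvedovsky2023, §2.4] -/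
def lowerLevels : AddSubgroup I :=
  HidaFamily.lowerLevels D.Gamma

/-- Unfolding `upperLevels`. [cite: ContiLangMedvedovsky2023, §2.3 (p. 9) and §2.4 (p. 10–11)] -/
theorem mem_upperLevels_iff (b : I) : b ∈ D.upperLevels ↔ HidaFamily.unipUpper b ∈ D.Gamma :=
  Iff.rfl

/-- Unfolding `lowerLevels`. [cite: ContiLangMedvedovsky2023, §2.3 (p. 9) and §2.4 (p. 10–11)] -/
theorem mem_lowerLevels_iff (c : I) : c ∈ D.lowerLevels ↔ HidaFamily.unipLower c ∈ D.Gamma :=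
  Iff.rfl

/-- `u ∈ 𝔲⁺` iff `U⁺(u) = ρ_𝓕(σ)` for some `σ ∈ G^cyc` and `u ∈ 𝔪_I` (the determinant condition is
automatic). [cite: ContiLangMedvedovsky2023, §2.3 (p. 9) and §2.4 (p. 10–11)] -/
theorem mem_upperLevels_iff' (b : I) :
    b ∈ D.upperLevels ↔
      (∃ σ : absoluteGaloisGroup ℚ, GaloisRep.cyclotomicCharacter ℚ p σ = 1 ∧
        D.rho σ = HidaFamily.unipUpper b) ∧ b ∈ IsLocalRing.maximalIdeal I := by
  rw [mem_upperLevels_iff, Gamma, HidaFamily.unipUpper_mem_pinkGamma_iff, mem_imageCyc_iff]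

/-- `u ∈ 𝔲⁻` iff `U⁻(u) = ρ_𝓕(σ)` for some `σ ∈ G^cyc` and `u ∈ 𝔪_I`. [cite: ContiLangMedvedovsky2023, §2.3 (p. 9) and §2.4 (p. 10–11)] -/
theorem mem_lowerLevels_iff' (c : I) :
    c ∈ D.lowerLevels ↔
      (∃ σ : absoluteGaloisGroup ℚ, GaloisRep.cyclotomicCharacter ℚ p σ = 1 ∧
        D.rho σ = HidaFamily.unipLower c) ∧ c ∈ IsLocalRing.maximalIdeal I := by
  rw [mem_lowerLevels_iff, Gamma, HidaFamily.unipLower_mem_pinkGamma_iff, mem_imageCyc_iff]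

/-- `𝔲⁺ ⊆ 𝔪_I`. [cite: ContiLangMedvedovsky2023, §2.3 (p. 9) and §2.4 (p. 10–11)] -/
theorem upperLevels_le_maximalIdeal : (D.upperLevels : Set I) ⊆ IsLocalRing.maximalIdeal I :=
  HidaFamily.upperLevels_pinkGamma_le _

/-- `𝔲⁻ ⊆ 𝔪_I`. [cite: ContiLangMedvedovsky2023, §2.3 (p. 9) and §2.4 (p. 10–11)] -/
theorem lowerLevels_le_maximalIdeal : (D.lowerLevels : Set I) ⊆ IsLocalRing.maximalIdeal I :=
  HidaFamily.lowerLevels_pinkGamma_le _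

/-! ### Level supply -/

/-- **Level supply at the ideal `P` of `I`** (the form filed with the request):
`¬ (𝔲⁺ ⊆ P ∧ 𝔲⁻ ⊆ P)`. [cite: Ochiai2005, Def. 2.3 (p. 123)] -/
def LevelSupplyAt (P : Ideal I) : Prop :=
  HidaFamily.LevelSupplyAt D.Gamma P

/-- **Two-sided level supply at `P`** (the consumer's shape sketch): `(∃ b ∈ 𝔲⁺, b ∉ P) ∧ (∃ c ∈ 𝔲⁻, c ∉ P)`.
[cite: Ochiai2005, Def. 2.3 (p. 123)] -/
def TwoSidedLevelSupplyAt (P : Ideal I) : Prop :=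
  HidaFamily.TwoSidedLevelSupplyAt D.Gamma P

/-- Unfolding `LevelSupplyAt` (definitional). [cite: Ochiai2005, Def. 2.3 (p. 123)] -/
theorem levelSupplyAt_def (P : Ideal I) :
    D.LevelSupplyAt P ↔ ¬ ((D.upperLevels : Set I) ⊆ P ∧ (D.lowerLevels : Set I) ⊆ P) :=
  Iff.rfl

/-- `LevelSupplyAt` as a disjunction of witnesses. [cite: Ochiai2005, Def. 2.3 (p. 123)] -/
theorem levelSupplyAt_iff (P : Ideal I) :
    D.LevelSupplyAt P ↔ (∃ b ∈ D.upperLevels, b ∉ P) ∨ (∃ c ∈ D.lowerLevels, c ∉ P) :=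
  HidaFamily.levelSupplyAt_iff _ _

/-- Unfolding `TwoSidedLevelSupplyAt` (definitional). [cite: Ochiai2005, Def. 2.3 (p. 123)] -/
theorem twoSidedLevelSupplyAt_def (P : Ideal I) :
    D.TwoSidedLevelSupplyAt P ↔ (∃ b ∈ D.upperLevels, b ∉ P) ∧ (∃ c ∈ D.lowerLevels, c ∉ P) :=
  Iff.rfl

/-- Two-sided supply implies supply. [cite: Ochiai2005, Def. 2.3 (p. 123)] -/
theorem TwoSidedLevelSupplyAt.levelSupplyAt {P : Ideal I} (h : D.TwoSidedLevelSupplyAt P) :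
    D.LevelSupplyAt P :=
  HidaFamily.TwoSidedLevelSupplyAt.levelSupplyAt h

/-- Supply is antitone in the ideal. [cite: Ochiai2005, Def. 2.3 (p. 123)] -/
theorem LevelSupplyAt.anti {P Q : Ideal I} (hQP : Q ≤ P) (h : D.LevelSupplyAt P) : D.LevelSupplyAt Q :=
  HidaFamily.LevelSupplyAt.anti hQP h

/-- There is no supply at `𝔪_I` itself (`𝔲^± ⊆ 𝔪_I`): supply is a condition on the height-one primes.
[cite: Ochiai2005, Def. 2.3 (p. 123)] -/
theorem not_levelSupplyAt_maximalIdeal : ¬ D.LevelSupplyAt (IsLocalRing.maximalIdeal I) :=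
  HidaFamily.not_levelSupplyAt_pinkGamma_maximalIdeal _

/-- **(FH1) of ROW 45 — level supply at every height-one prime**: no height-one prime of `I` contains
all the levels `𝔲⁺ ∪ 𝔲⁻`. [cite: Ochiai2005, Def. 2.3 (p. 123)] -/
def LevelSupply (D : HidaFamilyGaloisRepDatum W p I) : Prop :=
  ∀ P ∈ heightOnePrimes I, D.LevelSupplyAt P

/-! ### Reduction modulo an ideal and finite projective image -/

/-- `ρ_𝓕 mod P : Γ_ℚ → GL₂(I/P)` (Hida 1986, p. 559: "the reduction `π mod P`" — there semisimplified;
here the plain reduction of the integral frame). [cite: Hida1986, p. 559] -/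
def rhoMod (P : Ideal I) : absoluteGaloisGroup ℚ →* GL (Fin 2) (I ⧸ P) :=
  (Matrix.GeneralLinearGroup.map (Ideal.Quotient.mk P)).comp D.rho.toMonoidHom

/-- Unfolding `rhoMod`: the matrix of `(ρ mod P)(σ)` is `ρ(σ)` reduced entrywise. [cite: Hida1986, p. 559] -/
@[simp]
theorem coe_rhoMod_apply (P : Ideal I) (σ : absoluteGaloisGroup ℚ) :
    ((D.rhoMod P σ : GL (Fin 2) (I ⧸ P)) : Matrix (Fin 2) (Fin 2) (I ⧸ P)) =
      ((D.rho σ : GL (Fin 2) I) : Matrix (Fin 2) (Fin 2) I).map (Ideal.Quotient.mk P) :=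
  rfl

/-- **«`ρ_𝓕 mod P` has finite projective image»** (the second disjunct of US-S4: the weight-one /
CM-crossing primes). [cite: ContiLangMedvedovsky2023, §2 Notation (p. 7, "projective image") and §1 (p. 3, "a priori small")] -/
def FiniteProjectiveImageAt (P : Ideal I) : Prop :=
  HidaFamily.FiniteProjectiveImage (D.rhoMod P)

/-! ### The diagonal characters at `p` and the ordinary filtration (Greenberg–Selmer glue) -/

section AtP

variable (v : HeightOneSpectrum (𝓞 ℚ))

/-- The upper-left entry `θ_v(σ) = ε(σ)` of `ρ_𝓕` on the decomposition group at `v ∣ p` (a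
multiplicative character by `thetaHom`). [cite: ContiLangMedvedovsky2023, Prop. 6.6 (proof)] -/
def theta (σ : absoluteGaloisGroup (v.adicCompletion ℚ)) : I :=
  ((D.rho (absGaloisRestrict ℚ (v.adicCompletion ℚ) σ) : GL (Fin 2) I) : Matrix (Fin 2) (Fin 2) I) 0 0

/-- The lower-right entry `δ_v(σ)` of `ρ_𝓕` on the decomposition group at `v ∣ p` (the unramified
character `δ`). [cite: ContiLangMedvedovsky2023, Prop. 6.6 (proof)] -/
def delta (σ : absoluteGaloisGroup (v.adicCompletion ℚ)) : I :=
  ((D.rho (absGaloisRestrict ℚ (v.adicCompletion ℚ) σ) : GL (Fin 2) I) : Matrix (Fin 2) (Fin 2) I) 1 1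

variable {v} (hv : ((p : ℕ) : 𝓞 ℚ) ∈ v.asIdeal)
include hv

/-- `θ_v` is multiplicative (upper triangularity (iv)). [cite: ContiLangMedvedovsky2023, Prop. 6.6 (proof, p. 39)] -/
theorem theta_mul (σ τ : absoluteGaloisGroup (v.adicCompletion ℚ)) :
    D.theta v (σ * τ) = D.theta v σ * D.theta v τ := by
  simp only [theta, map_mul, Units.val_mul, Matrix.mul_apply, Fin.sum_univ_two]
  rw [D.apply_one_zero_eq_zero v hv τ, mul_zero, add_zero]

/-- `δ_v` is multiplicative (upper triangularity (iv)). [cite: ContiLangMedvedovsky2023, Prop. 6.6 (proof, p. 39)] -/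
theorem delta_mul (σ τ : absoluteGaloisGroup (v.adicCompletion ℚ)) :
    D.delta v (σ * τ) = D.delta v σ * D.delta v τ := by
  simp only [delta, map_mul, Units.val_mul, Matrix.mul_apply, Fin.sum_univ_two]
  rw [D.apply_one_zero_eq_zero v hv σ, zero_mul, zero_add]

/-- `θ_v δ_v = det ρ_𝓕` on the decomposition group. [cite: ContiLangMedvedovsky2023, Prop. 6.6 (proof, p. 39)] -/
theorem theta_mul_delta (σ : absoluteGaloisGroup (v.adicCompletion ℚ)) :
    D.theta v σ * D.delta v σ =
      ((FramedRep.det D.rho (absGaloisRestrict ℚ (v.adicCompletion ℚ) σ) : Iˣ) : I) := by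
  rw [FramedRep.det_apply, Matrix.GeneralLinearGroup.val_det_apply, Matrix.det_fin_two,
    D.apply_one_zero_eq_zero v hv σ, mul_zero, sub_zero]
  rfl

/-- `θ_v : D_v →* I` as a monoid homomorphism (values are units: `theta_mul_delta`). [cite: ContiLangMedvedovsky2023, Prop. 6.6 (proof, p. 39)] -/
def thetaHom : absoluteGaloisGroup (v.adicCompletion ℚ) →* I where
  toFun := D.theta v
  map_one' := by simp [theta]
  map_mul' := D.theta_mul hv

/-- `δ_v : D_v →* I` as a monoid homomorphism. [cite: ContiLangMedvedovsky2023, Prop. 6.6 (proof, p. 39)] -/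
def deltaHom : absoluteGaloisGroup (v.adicCompletion ℚ) →* I where
  toFun := D.delta v
  map_one' := by simp [delta]
  map_mul' := D.delta_mul hv

/-- Unfolding `thetaHom`. [cite: ContiLangMedvedovsky2023, Prop. 6.6 (proof, p. 39)] -/
@[simp]
theorem thetaHom_apply (σ : absoluteGaloisGroup (v.adicCompletion ℚ)) : D.thetaHom hv σ = D.theta v σ :=
  rfl

/-- Unfolding `deltaHom`. [cite: ContiLangMedvedovsky2023, Prop. 6.6 (proof, p. 39)] -/
@[simp]
theorem deltaHom_apply (σ : absoluteGaloisGroup (v.adicCompletion ℚ)) : D.deltaHom hv σ = D.delta v σ :=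
  rfl

/-- `δ_v` is unramified: trivial on the inertia group ((iv), second clause). [cite: ContiLangMedvedovsky2023, Prop. 6.6 (proof, p. 39)] -/
theorem delta_eq_one_of_mem_absInertia {σ : absoluteGaloisGroup (v.adicCompletion ℚ)}
    (hσ : σ ∈ absInertia (v.adicCompletion ℚ)) : D.delta v σ = 1 :=
  D.apply_one_one_eq_one v hv σ hσ

/-- `θ_v|_{I_v}` has infinite order ((iv), third clause). [cite: ContiLangMedvedovsky2023, Prop. 6.6 (proof, p. 39)] -/
theorem exists_not_isOfFinOrder_theta :
    ∃ σ ∈ absInertia (v.adicCompletion ℚ), ¬ IsOfFinOrder (D.theta v σ) :=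
  D.exists_not_isOfFinOrder v hv

/-- **The ordinary line is `D_v`-stable**: the `PlusPart` of `ρ_𝓕` at `v ∣ p` given by `I·e₁`
(input of the tree's `greenbergSelmer`). [cite: ContiLangMedvedovsky2023, Prop. 6.6 (proof)] [cite: Wiles1988, Thm. 2.2] -/
def plusPart : PlusPart D.rho v where
  plus := plusLine I
  smul_mem σ {y} hy := by
    rw [mem_plusLine_iff] at hy ⊢
    simp [Matrix.mulVec, dotProduct, Fin.sum_univ_two, hy, D.apply_one_zero_eq_zero v hv σ]

/-- Unfolding `plusPart`. [cite: Wiles1988, Thm. 2.2] -/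
@[simp]
theorem plusPart_plus : (D.plusPart hv).plus = plusLine I :=
  rfl

/-- **The ordinary filtration of `ρ_𝓕` at `v ∣ p`** in the sense of the tree's `OrdinaryFiltration`
(EPW (eq:ordes)): `I·e₁` is a `D_v`-stable rank-one direct summand with unramified quotient — proved
from (iv). [cite: Wiles1988, Thm. 2.2] [cite: ContiLangMedvedovsky2023, Prop. 6.6 (proof)] -/
def ordinaryFiltration : OrdinaryFiltration D.rho v where
  toPlusPart := D.plusPart hv
  exists_isCompl := ⟨minusLine I, isCompl_plusLine_minusLine⟩
  finrank_eq_one := finrank_plusLine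
  unramified σ hσ y := by
    change _ ∈ plusLine I
    rw [mem_plusLine_iff]
    simp [D.apply_one_zero_eq_zero v hv σ, D.apply_one_one_eq_one v hv σ hσ]

/-- Unfolding `ordinaryFiltration`. [cite: Wiles1988, Thm. 2.2] -/
@[simp]
theorem ordinaryFiltration_plus : (D.ordinaryFiltration hv).plus = plusLine I :=
  rfl

end AtP

/-- The ordinary data `(T⁺_v)_{v ∣ p}` of the datum, in the shape consumed by the tree's
`greenbergSelmer` (cf. `OrdinaryNewformDatum.plus`). [cite: Wiles1988, Thm. 2.2] -/
def plus : ∀ v : HeightOneSpectrum (𝓞 ℚ), ((p : ℕ) : 𝓞 ℚ) ∈ v.asIdeal → PlusPart D.rho v :=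
  fun _ hv => D.plusPart hv

/-! ### Specialisations -/

/-- The point of `W` is `ℤ_p`-linear: `specW` restricted to the constants `ℤ_p ⊆ Λ` is the inclusion
`ℤ_p ⊆ ℚ̄_p`. [cite: Hida1986, Thm. 2.1 (p. 559)] -/
theorem specW_algebraMap_C (a : ℤ_[p]) :
    D.specW (algebraMap (IwasawaAlgebra p) I (PowerSeries.C a)) =
      algebraMap ℚ_[p] (PadicAlgCl p) (a : ℚ_[p]) := by
  rw [D.specW_algebraMap, PowerSeries.constantCoeff_C]

/-- The point of `W` lies over `X ↦ 0` (the weight-`2` point of `Λ` in the convention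
`x_k = (1+p)^{k−2} − 1`). [cite: Hida1986, Thm. 2.1 (p. 559)] -/
theorem specW_algebraMap_X : D.specW (algebraMap (IwasawaAlgebra p) I PowerSeries.X) = 0 := by
  rw [D.specW_algebraMap, PowerSeries.constantCoeff_X]
  simp

/-- The kernel of the point of `W` is a prime ideal of `I` (`ℚ̄_p` is a domain). [cite: Hida1986, Thm. 2.1 (p. 559)] -/
theorem ker_specW_isPrime : (RingHom.ker D.specW).IsPrime :=
  RingHom.ker_isPrime _

/-- Every arithmetic point is integral-valued. [cite: Hida1986, Thm. 2.1 (p. 559)] -/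
theorem norm_le_one_of_mem_arithPoints {φ : I →+* PadicAlgCl p} (hφ : φ ∈ D.arithPoints) (x : I) :
    ‖φ x‖ ≤ 1 :=
  (D.classical_arithPoints φ hφ).1 x

/-- Zariski density of the arithmetic points, contrapositive form: an element killed by every
arithmetic point is `0`. [cite: Hida1986, p. 559] -/
theorem eq_zero_of_forall_arithPoints {x : I} (h : ∀ φ ∈ D.arithPoints, φ x = 0) : x = 0 := by
  by_contra hx
  obtain ⟨φ, hφ, hφx⟩ := D.dense_arithPoints x hx
  exact hφx (h φ hφ)

end HidaFamilyGaloisRepDatum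

end Literature.NumberTheory.EllipticCurves

end
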